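import Literature.RepresentationTheory.TwistedCoinvariantsSemilinear
import Literature.RepresentationTheory.HeisenbergGroup.SchrodingerConjugate
import HarnessLib

/-!
# Types of the COMPLEX-CONJUGATE representation on `𝒮(X)`: `Coinv_η(ρ) ≠ 0 ⟺ Coinv_{η̄}(ρ̄) ≠ 0` — the type set of the
# conjugate oscillator representation is the INVERSE type set

Topic `RepresentationTheory`; namespace `Literature.RepresentationTheory.TwistedCoinv` (sequel of ★ `TwistedCoinvariantsSemilinear`, whose
semilinear functoriality `mapₛₗ` it instantiates at complex conjugation).  KERNEL ONLY: theorems; no definition, no named fact, no `sorry`.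
Cell hodgecm-mathlib, fan B rung B-IV (local theta: types of oscillator representations); `--supports stmt-HodgeConjecture-24832`.

Two representations `ρ, ρ'` of a group `K` on the Schwartz–Bruhat space `𝒮(X)` (complex, with the pointwise conjugation ★ `conjSB`) are
CONJUGATE when `ρ' k (f̄) = \overline{ρ k f}` for all `k, f` — e.g. `ρ' k = conjOp (ρ k)` (★ `conjOp`), which is how the oscillator
representation of the opposite symplectic space `𝕎⁻` is realised on `𝒮` ([MoeglinVignerasWaldspurger1987, Chap. 2 II.1 Remarque; Chap. 4 II.1];
[HarrisKudlaSweet1996, §1 (1.4)]; tree ★ `MpPsi.conjHom`, ★ `toRep_conjHom`, ★ `toRep_diagonalDoubling_boxSB`).  Then: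

* `nontrivial_coinv_iff_of_conj` — for characters `η, η'` with `η' k = \overline{η k}`: `Coinv_η(ρ) ≠ 0 ⟺ Coinv_{η'}(ρ') ≠ 0` (★ `mapₛₗ` along the
  conjugate-linear involution `conjSB`, bijective by ★ `mapₛₗ_bijective`, then ★ `nontrivial_iff_of_mapₛₗ_bijective`);
* `nontrivial_coinv_iff_inv_of_conj` — for a UNITARY `η` (`‖η k‖ = 1`) this reads `Coinv_η(ρ) ≠ 0 ⟺ Coinv_{η⁻¹}(ρ') ≠ 0`: **the types of the
  conjugate representation are the inverses of the types** («`ω^∨ ≅ ω̄`»: the contragredient/conjugate of the Weil representation,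
  [MoeglinVignerasWaldspurger1987, Chap. 2 II.1 Remarque]) — the symmetry of type sets used by the see-saw on the anisotropic plane
  ([Liu2021, Lem. D.1 (1)]: `Θ_s(χ) ≠ 0` iff the types of `ω_{s₁}` meet those of `χ ⊗ \overline{ω_{s₂}}`).

HC_CM is proved only modulo the printed citations — the 2 remaining named inputs (hLiu418 = stmt-HodgeConjecture-24832, h413 = 24833) — until rung 0
closes; count-neutral.

## References
* [MoeglinVignerasWaldspurger1987] C. Mœglin, M.-F. Vignéras, J.-L. Waldspurger, LNM 1291 (1987), Chap. 2 II.1 (A) and Remarque; Chap. 4 II.1.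
* [HarrisKudlaSweet1996] M. Harris, S. Kudla, W. J. Sweet, J. AMS 9 (1996), §1 (1.4).
* [Liu2021] Y. Liu, Camb. J. Math. 9 (2021), App. D Lem. D.1 (1).
-/

set_option autoImplicit false

noncomputable section

open scoped ComplexConjugate
open Literature.NumberTheory.Automorphic (SchwartzBruhat)
open Literature.RepresentationTheory.HeisenbergGroup

namespace Literature.RepresentationTheory.TwistedCoinv

universe v

variable {K : Type*} [Group K] {X : Type v} [TopologicalSpace X]
  (ρ ρ' : Representation ℂ K (SchwartzBruhat X)) (hconj : ∀ (k : K) (f : SchwartzBruhat X), ρ' k (conjSB f) = conjSB (ρ k f))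

include hconj in
/-- **`Coinv_η(ρ) ≠ 0 ⟺ Coinv_{η̄}(ρ̄) ≠ 0`** for CONJUGATE representations `ρ, ρ'` of `K` on `𝒮(X)` (`ρ' k f̄ = \overline{ρ k f}`) and characters with
`η' = η̄` pointwise: complex conjugation `conjSB` is a conjugate-linear involution intertwining `ρ` with `ρ'`, so it induces a bijection
`Coinv_η(ρ) → Coinv_{η'}(ρ')` (★ `mapₛₗ`, ★ `mapₛₗ_bijective`). [cite: MoeglinVignerasWaldspurger1987, Chap. 2 II.1 Remarque; Chap. 4 II.1]
[cite: HarrisKudlaSweet1996, §1 (1.4)] -/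
theorem nontrivial_coinv_iff_of_conj (η η' : K →* ℂˣ) (hη : ∀ k : K, ((η' k : ℂˣ) : ℂ) = conj ((η k : ℂˣ) : ℂ)) :
    Nontrivial (Coinv ρ η) ↔ Nontrivial (Coinv ρ' η') := by
  -- complex conjugation on `𝒮(X)` as a conjugate-linear map (★ `conjSB_add`, ★ `conjSB_smul`)
  let T : SchwartzBruhat X →ₛₗ[starRingEnd ℂ] SchwartzBruhat X :=
    { toFun := conjSB, map_add' := conjSB_add, map_smul' := conjSB_smul }
  have hTapp : ∀ f, T f = conjSB f := fun _ => rfl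
  -- `conjSB` intertwines: `ρ' k (T f) = T (ρ k f)`, and back
  have hT : ∀ (k : K) (f : SchwartzBruhat X), ρ' k (T f) = T (ρ k f) := fun k f => by
    rw [hTapp, hTapp, hconj]
  have hT' : ∀ (k : K) (f : SchwartzBruhat X), ρ k (T f) = T (ρ' k f) := fun k f => by
    rw [hTapp, hTapp]
    have h := congrArg conjSB (hconj k (conjSB f))
    rw [conjSB_conjSB, conjSB_conjSB] at h
    exact h.symm
  have hη' : ∀ k : K, ((η k : ℂˣ) : ℂ) = (starRingEnd ℂ) ((η' k : ℂˣ) : ℂ) := fun k => by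
    rw [hη k, Complex.conj_conj]
  exact nontrivial_iff_of_mapₛₗ_bijective ρ η ρ' η' T hT hη
    (mapₛₗ_bijective ρ η ρ' η' T hT hη T hT' hη' (fun f => by rw [hTapp, hTapp, conjSB_conjSB])
      (fun f => by rw [hTapp, hTapp, conjSB_conjSB]))

include hconj in
/-- **The types of the conjugate representation are the INVERSES of the types**: for a UNITARY character `η` of `K` (`‖η k‖ = 1`, so `η̄ = η⁻¹`),
`Coinv_η(ρ) ≠ 0 ⟺ Coinv_{η⁻¹}(ρ') ≠ 0` whenever `ρ' k f̄ = \overline{ρ k f}` («`ω̄ ≅ ω^∨`»).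
[cite: MoeglinVignerasWaldspurger1987, Chap. 2 II.1 Remarque; Chap. 4 II.1] [cite: HarrisKudlaSweet1996, §1 (1.4)] -/
theorem nontrivial_coinv_iff_inv_of_conj (η : K →* ℂˣ) (hηu : ∀ k, ‖((η k : ℂˣ) : ℂ)‖ = 1) :
    Nontrivial (Coinv ρ η) ↔ Nontrivial (Coinv ρ' η⁻¹) := by
  refine nontrivial_coinv_iff_of_conj ρ ρ' hconj η η⁻¹ fun k => ?_
  -- `(η k)⁻¹ = conj (η k)` for `‖η k‖ = 1`
  rw [MonoidHom.inv_apply, Units.val_inv_eq_inv_val]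
  exact Complex.inv_eq_conj (hηu k)

end Literature.RepresentationTheory.TwistedCoinv

end
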